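import Literature.AnabelianGeometry.EtaleTheta.Discharge.Sec2Prop214iiiTranslationsOfModel
import Literature.AnabelianGeometry.EtaleTheta.Discharge.Sec2Prop214iiiBiUpperHUModelTate
import Literature.AnabelianGeometry.EtaleTheta.Discharge.Sec1Thm110ModelTateNV
import HarnessLib

/-!
# [EtTh] Remark 2.18.1: the odd-lifting clause («bijective if `N/M` is odd») of Cor. 2.18 (iv) FAILS for BI-theta
# environments — at the §1-model tower of any setting (⟸ print's Prop. 1.5 (ii)(iii) inputs) and UNCONDITIONALLY at the
# Tate datum of record (proof-only; cone node EtTh:Rmk2.18.1, R-b → decl)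

S. Mochizuki, *The étale theta function and its Frobenioid-theoretic manifestations* [EtTh], Publ. RIMS **45** (2009),
§2, Remark 2.18.1, PRIMS PDF p. 63 (printed p. 289) [cite: MochizukiEtTh2009, Rmk 2.18.1 p.63]: «It follows immediately from
Proposition 2.14, (iii), that, for instance, the bijectivity [i.e., "if `N/M` is odd"] of the latter portion of Corollary 2.18,
(iv), is false for bi-theta environments.»; Prop. 2.14 (iii) pp. 49–51 («`(N·l·ℤ) ⋊ {±1} ⊆ Im_N ⊆ (N†·l·ℤ) ⋊ {±1}`»);
Cor. 2.18 (iv) pp. 61–62 («hence is a bijection if `N/M` is odd»).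

abc-iut cell, layer L2, seat abc-iut-L2-d1 (gen 7); abc-iut-L2-lead gen 7 «GO L2-d1 RMK2181-BI-NOGO» (M13 «§2 REMARKS» census,
R1072 class R-b → decl for EtTh:Rmk2.18.1). PROOF-ONLY: 0 definitions / instances / `Prop` facts; nothing of another seat
edited or restated — abc-iut-L2-t2's Prop. 2.14 (iii) bi-theta files are consumed BY NAME.

THE STATEMENT NEGATED. `ThetaEnvTower.Cor218_iv_bijective_of_odd` (abc-iut-L2-t2, `ThetaSystems`, F-0647) types the printed
«bijection if `N/M` odd» for the model MONO-theta environments of a tower `T`: (surjectivity) every automorphism of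
`M_M(red η′)` lifts, up to `μ_M`-conjugacy, along `T.Reduces` to an automorphism of `M_{M′}(η′)`; (injectivity) … . The remark
says the bi-theta analogue fails; we negate the SURJECTIVITY half with `(T.level M).modelBi` (Def. 2.13 (iii) model bi-theta
environments) in place of `modelMono`, spelled out inline (no new `Prop` definition).

RESULTS.
§1 `ThetaSetting.EtaleThetaData.DoubleUnderline.not_forall_biIso_lift_of_model` — at the §1-model tower
`T := C.thetaEnvTower τ hC hS` of ANY setting, for levels `M ∣ M'` in `Es` with `M' ∤ 2M` (e.g. `M' = 3M`: `M'/M = 3` ODD):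
NOT every automorphism of `B_M(red η′)` lifts. Binders = print's own inputs BY NAME: `Prop15iii` (F-0591), `Prop15ii` (F-2503),
`hU` («`l·log(Ü)` maps `Δ^tp_Ÿ̲̲` onto `μ_{M′}`» = the mod-`M′` content of Prop. 1.5 (ii)'s «`F̈¹/F̈² = Ẑ·log(Ü)`», abc-iut-L2-t2's
binder shape), any labelling `L`. PROOF = print's: the level-`M` translation by `x₁^M` (`x₁` a geometric generator of
`Gal(Y̲̲/X̲̲)`) IS an automorphism of `B_M` by the LOWER bound `(M·l·ℤ) ⊆ Im_M` (abc-iut-L2-t2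
`exists_generator_biIso_conjX_zpow_of_model`, p. 50 «translations lift»); a lift `α′` would be an automorphism of `B_{M′}` lying over
`conj(x₁^M)` on `Π^tp_Y̲̲` (`Reduces` is the identity on the `Π^tp_Y̲̲`-quotient, `μ`-conjugation is trivial there — read off the
`right` components), so the UPPER bound `Im_{M′} ⊆ (M′†·l·ℤ)` (abc-iut-L2-t2 `dvd_two_mul_zExp_of_biIso_over_conj_tower`, p. 51
«`2a ≡ 0 (mod N)`») gives `M′ ∣ 2·zExp(x₁^M) = 2M` — contradiction.
§2 `SettingModel.not_forall_biIso_lift_modelTate_inr` — the same UNCONDITIONALLY at the Tate datum of record (`modelχq p 1 2`,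
`E := etaleThetaDataχqInr p`, record `X̲̲`-choice `C.Huu = Huuχq`, any tower, EMPTY labelling): `Prop15iii` / `Prop15ii`
(abc-iut-w5-d171 `prop15iii_etaleThetaDataχqInr` / `prop15ii_etaleThetaDataχqInr`) and `hU` (abc-iut-L2-t2
`exists_logUdd_rep_geometric_surjective_modelχq` + `red_pow_logUdd_surjective_of_logUdd_surjective`) DISCHARGED BY NAME; and
`not_forall_biIso_lift_three_mul_modelTate_inr` — the printed instance `M' = 3M` (`not_three_mul_dvd_two_mul`).

HONEST FRAMING: a kernel-checked instance of print's OWN negative remark about OUR typed rows (model bi-theta environments of the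
§1-model tower / the semi-synthetic Tate datum); F-0647 and Prop. 2.14 (iii) stay FACT-policy rows (assumption labels by ID);
nothing of [EtTh] (refereed) is asserted beyond the displayed statements; no side is taken on [IUTchIII] Cor. 3.12; typed ≠
proved; a negative at OUR model tower ≠ a statement about print beyond Rmk. 2.18.1's own sentence; nothing here says abc is proved
or refuted.
-/

noncomputable section

namespace Literature.AnabelianGeometry.EtaleTheta

namespace ThetaSetting.EtaleThetaData.DoubleUnderline

open Literature.AnabelianGeometry.SemiGraphs

variable {p : ℕ} [Fact p.Prime] {D : ThetaSetting p} {E : D.EtaleThetaData} {l : ℕ}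
  (C : E.DoubleUnderline l) {Es : Set ℕ+} (τ : D.CyclotomeTower l Es)

/-- **[EtTh] Rmk. 2.18.1 at the §1-model tower** («It follows immediately from Proposition 2.14, (iii), that … the
bijectivity [i.e., "if `N/M` is odd"] of the latter portion of Corollary 2.18, (iv), is false for bi-theta environments»,
p. 63): for the model tower `T := C.thetaEnvTower τ hC hS` of ANY §1 setting and levels `M ∣ M'` in `Es` with
`M' ∤ 2M` (e.g. `M' = 3M`, so that `M'/M = 3` is ODD), the SURJECTIVITY half of `ThetaEnvTower.Cor218_iv_bijective_of_odd`
with the model BI-theta environments `B_M = (T.level M).modelBi` in place of the mono-theta ones FAILS: NOT every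
automorphism of `B_M(red η′)` lifts, up to `μ_M`-conjugacy, along `Reduces` to an automorphism of `B_{M′}(η′)`.
WITNESS (print's proof): the level-`M` translation by `x₁^M`, `x₁` a geometric generator of `Gal(Y̲̲/X̲̲)` — an automorphism
of `B_M` by the LOWER bound `(M·l·ℤ) ⊆ Im_M` (abc-iut-L2-t2 `exists_generator_biIso_conjX_zpow_of_model`); a lift `α′` would
be an automorphism of `B_{M′}` over `conj(x₁^M)` (`Reduces` is the identity on the `Π^tp_Y̲̲`-quotient, `μ`-conjugation
acts trivially there), so the UPPER bound `Im_{M′} ⊆ (M′†·l·ℤ)` (abc-iut-L2-t2 `dvd_two_mul_zExp_of_biIso_over_conj`) gives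
`M′ ∣ 2·zExp(x₁^M) = 2M` — contradiction. Binders = print's own inputs BY NAME: `Prop15iii` (F-0591), `Prop15ii`
(F-2503), `hU` («`l·log(Ü)` maps `Δ^tp_Ÿ̲̲` onto `μ_{M′}` after reduction» = the mod-`M′` content of Prop. 1.5 (ii)'s
«`F̈¹/F̈² = Ẑ·log(Ü)`»), any labelling `L`. [cite: MochizukiEtTh2009, Rmk 2.18.1 p.63] -/
theorem not_forall_biIso_lift_of_model (hC : D.Compat) (hS : D.Sec2Hyps) (h15 : Prop15iii E hC)
    (h15ii : Prop15ii E.toKummerData hC) (L : C.CuspLabels) (M M' : Es) (h : (M : ℕ+) ∣ M')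
    (hM' : ¬ (((M' : ℕ+) : ℕ) : ℤ) ∣ 2 * (((M : ℕ+) : ℕ) : ℤ))
    (hU : ∃ c : contCocycles (MonoidHom.id D.GtpTheta) D.DeltaTheta (D.GtpYdd.map D.toTheta),
      (QuotientGroup.mk c : D.H1Theta (D.GtpYdd.map D.toTheta)) = E.logUdd ∧
      ∀ m : MuN p M', ∃ (g : C.GtpYdduu) (_ : (g : D.PiTemp) ∈ D.DeltaTemp),
        (τ.mod M').red ⟨((c.1 ⟨D.toTheta g, ⟨g, (Subgroup.mem_inf.1 g.2).1, rfl⟩⟩ ^ l : D.DeltaTheta) :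
          D.GtpTheta), coe_pow_mem_lDeltaTheta l _⟩ = m) :
    ¬ ∀ (η' : (C.thetaEnvTower τ hC hS).PiYdd → (C.thetaEnvTower τ hC hS).mu M')
        (hη' : η' ∈ (C.thetaEnvTower τ hC hS).thetaCocycles M')
        (α : (((C.thetaEnvTower τ hC hS).level M).modelBi
            ((C.thetaEnvTower τ hC hS).red_cocycle_mem M M' h η' hη')).Iso
          (((C.thetaEnvTower τ hC hS).level M).modelBi
            ((C.thetaEnvTower τ hC hS).red_cocycle_mem M M' h η' hη'))),
        ∃ (α' : (((C.thetaEnvTower τ hC hS).level M').modelBi hη').Iso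
            (((C.thetaEnvTower τ hC hS).level M').modelBi hη')) (c : (C.thetaEnvTower τ hC hS).mu M),
          (C.thetaEnvTower τ hC hS).Reduces h α'.e.toMulEquiv
            (MulAut.conj (CycEnvelope.inMu ((C.thetaEnvTower τ hC hS).level M).augY
              ((C.thetaEnvTower τ hC hS).chi M) c) * α.e.toMulEquiv) := by
  set T := C.thetaEnvTower τ hC hS with hT
  intro H
  -- a theta cocycle at level `M'`
  obtain ⟨η', hη'⟩ := T.thetaCocycles_nonempty M'
  -- the geometric generator and the level-`M` translation by `x₁^M` as an automorphism of `B_M`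
  obtain ⟨x₁, hx1, hxaug, hlow⟩ := C.exists_generator_biIso_conjX_zpow_of_model τ hC hS h15 h15ii
  obtain ⟨α, hα⟩ := hlow M (T.red M M' h ∘ η') (T.red_cocycle_mem M M' h η' hη')
    (((M : ℕ+) : ℕ) : ℤ) (dvd_refl _)
  -- a hypothetical lift
  obtain ⟨α', c, hred⟩ := H η' hη' α
  -- `α'` lies over conjugation by `x₁ ^ M` on `Π^tp_Y̲̲`: read the `Π^tp_Y̲̲`-components of `hred`
  -- (`redEnv` is the identity there, `inMu c` has trivial `Π^tp_Y̲̲`-component, `conjX g` conjugates by `g`)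
  have hαr : ∀ w : (T.level M).env, (((α.e w).right : (T.level M).PiY) : C.Huu) =
      x₁ ^ (((M : ℕ+) : ℕ) : ℤ) * ((w.right : (T.level M).PiY) : C.Huu) * (x₁ ^ (((M : ℕ+) : ℕ) : ℤ))⁻¹ :=
    fun w => by rw [hα]; rfl
  have hα' : ∀ z, ((CycEnvelope.proj (T.level M').augY (T.level M').chi (α'.e z) :
        (T.level M').PiY) : C.Huu) =
      x₁ ^ (((M : ℕ+) : ℕ) : ℤ) * ((CycEnvelope.proj (T.level M').augY (T.level M').chi z :
        (T.level M').PiY) : C.Huu) * (x₁ ^ (((M : ℕ+) : ℕ) : ℤ))⁻¹ := by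
    intro z
    have h2 := congrArg (fun w : (T.level M).env => ((w.right : (T.level M).PiY) : C.Huu)) (hred z)
    have rhs : (fun w : (T.level M).env => ((w.right : (T.level M).PiY) : C.Huu))
        ((MulAut.conj (CycEnvelope.inMu (T.level M).augY (T.chi M) c) * α.e.toMulEquiv)
          (T.redEnv M M' h z)) =
        x₁ ^ (((M : ℕ+) : ℕ) : ℤ) * ((CycEnvelope.proj (T.level M').augY (T.level M').chi z :
          (T.level M').PiY) : C.Huu) * (x₁ ^ (((M : ℕ+) : ℕ) : ℤ))⁻¹ := by
      change ((((1 : (T.level M).PiY) * (α.e (T.redEnv M M' h z)).right * (1 : (T.level M).PiY)⁻¹ :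
          (T.level M).PiY) : C.Huu)) = _
      rw [one_mul, inv_one, mul_one, hαr]
      rfl
    exact h2.trans rhs
  -- the UPPER bound at level `M'`: `M' ∣ 2 · zExp (x₁ ^ M)`
  have hdiv : (((M' : ℕ+) : ℕ) : ℤ) ∣ 2 * C.zExp (x₁ ^ (((M : ℕ+) : ℕ) : ℤ)) :=
    C.dvd_two_mul_zExp_of_biIso_over_conj_tower τ M' hC hS h15 h15ii L hU hη' _ α' hα'
  -- `zExp (x₁ ^ M) = M` (`galYX (mk x₁) = toLZ x₁ = ofAdd (zExp x₁)` definitionally)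
  have hz1 : C.zExp x₁ = 1 :=
    Multiplicative.ofAdd.injective (show C.toLZ x₁ = Multiplicative.ofAdd 1 from hx1)
  have hzM : C.zExp (x₁ ^ (((M : ℕ+) : ℕ) : ℤ)) = (((M : ℕ+) : ℕ) : ℤ) := by
    have hpow := map_zpow C.toLZ x₁ (((M : ℕ+) : ℕ) : ℤ)
    change Multiplicative.ofAdd (C.zExp (x₁ ^ (((M : ℕ+) : ℕ) : ℤ))) =
      (Multiplicative.ofAdd (C.zExp x₁)) ^ (((M : ℕ+) : ℕ) : ℤ) at hpow
    rw [← ofAdd_zsmul, hz1, smul_eq_mul, mul_one] at hpow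
    exact Multiplicative.ofAdd.injective hpow
  rw [hzM] at hdiv
  exact hM' hdiv

end ThetaSetting.EtaleThetaData.DoubleUnderline

/-! ## §2. The Tate datum of record: every binder DISCHARGED -/

namespace SettingModel

open Literature.AnabelianGeometry.SemiGraphs

variable (p : ℕ) [Fact p.Prime] {l : ℕ+} (hl : Odd (l : ℕ))
  (C : (etaleThetaDataχqInr p).DoubleUnderline l) (hHuu : C.Huu = Huuχq p 1 2 l hl) {Es : Set ℕ+}
  (τ : (ThetaSetting.modelχq p 1 2 even_two).CyclotomeTower l Es)

include hHuu in
/-- **[EtTh] Rmk. 2.18.1 UNCONDITIONALLY at the Tate datum of record** (`modelχq p 1 2`, `E := etaleThetaDataχqInr p`,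
the record `X̲̲`-choice `C.Huu = Huuχq`, ANY cyclotome tower `τ`, EMPTY labelling): for levels `M ∣ M'` in `Es` with
`M' ∤ 2M`, NOT every automorphism of the model bi-theta environment `B_M` lifts (up to `μ_M`-conjugacy, along `Reduces`)
to `B_{M′}` — the generic theorem with Prop. 1.5 (iii) / (ii) and the `log(Ü)`-surjectivity clause DISCHARGED BY NAME
(abc-iut-w5-d171 `prop15iii_etaleThetaDataχqInr` / `prop15ii_etaleThetaDataχqInr`, abc-iut-L2-t2
`exists_logUdd_rep_geometric_surjective_modelχq` + `red_pow_logUdd_surjective_of_logUdd_surjective`). Binders = data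
(`l` odd, `C`, `hHuu`, `τ`, `M`, `M'`) and the two arithmetic conditions only. [cite: MochizukiEtTh2009, Rmk 2.18.1 p.63] -/
theorem not_forall_biIso_lift_modelTate_inr (M M' : Es) (h : (M : ℕ+) ∣ M')
    (hM' : ¬ (((M' : ℕ+) : ℕ) : ℤ) ∣ 2 * (((M : ℕ+) : ℕ) : ℤ)) :
    ¬ ∀ (η' : (C.thetaEnvTower τ (compat_modelχq p 1 2 even_two) (ThetaSetting.modelχq_sec2Hyps p 1 2 even_two)).PiYdd → (C.thetaEnvTower τ (compat_modelχq p 1 2 even_two) (ThetaSetting.modelχq_sec2Hyps p 1 2 even_two)).mu M') (hη' : η' ∈ (C.thetaEnvTower τ (compat_modelχq p 1 2 even_two) (ThetaSetting.modelχq_sec2Hyps p 1 2 even_two)).thetaCocycles M')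
        (α : (((C.thetaEnvTower τ (compat_modelχq p 1 2 even_two) (ThetaSetting.modelχq_sec2Hyps p 1 2 even_two)).level M).modelBi ((C.thetaEnvTower τ (compat_modelχq p 1 2 even_two) (ThetaSetting.modelχq_sec2Hyps p 1 2 even_two)).red_cocycle_mem M M' h η' hη')).Iso
          (((C.thetaEnvTower τ (compat_modelχq p 1 2 even_two) (ThetaSetting.modelχq_sec2Hyps p 1 2 even_two)).level M).modelBi ((C.thetaEnvTower τ (compat_modelχq p 1 2 even_two) (ThetaSetting.modelχq_sec2Hyps p 1 2 even_two)).red_cocycle_mem M M' h η' hη'))),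
        ∃ (α' : (((C.thetaEnvTower τ (compat_modelχq p 1 2 even_two) (ThetaSetting.modelχq_sec2Hyps p 1 2 even_two)).level M').modelBi hη').Iso (((C.thetaEnvTower τ (compat_modelχq p 1 2 even_two) (ThetaSetting.modelχq_sec2Hyps p 1 2 even_two)).level M').modelBi hη')) (c : (C.thetaEnvTower τ (compat_modelχq p 1 2 even_two) (ThetaSetting.modelχq_sec2Hyps p 1 2 even_two)).mu M),
          (C.thetaEnvTower τ (compat_modelχq p 1 2 even_two) (ThetaSetting.modelχq_sec2Hyps p 1 2 even_two)).Reduces h α'.e.toMulEquiv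
            (MulAut.conj (CycEnvelope.inMu ((C.thetaEnvTower τ (compat_modelχq p 1 2 even_two) (ThetaSetting.modelχq_sec2Hyps p 1 2 even_two)).level M).augY ((C.thetaEnvTower τ (compat_modelχq p 1 2 even_two) (ThetaSetting.modelχq_sec2Hyps p 1 2 even_two)).chi M) c) * α.e.toMulEquiv) := by
  obtain ⟨c, hcL, hc⟩ :=
    exists_logUdd_rep_geometric_surjective_modelχq p 1 2 even_two (etaleThetaDataχqInr p) rfl l hl C hHuu
  exact C.not_forall_biIso_lift_of_model τ (compat_modelχq p 1 2 even_two)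
    (ThetaSetting.modelχq_sec2Hyps p 1 2 even_two) (prop15iii_etaleThetaDataχqInr p _)
    (prop15ii_etaleThetaDataχqInr p _) ⟨fun _ => ∅, fun _ => ∅, fun _ => rfl⟩ M M' h hM'
    ⟨c, hcL, C.red_pow_logUdd_surjective_of_logUdd_surjective (τ.mod M') c hc⟩

/-- `3M ∤ 2M` for a positive `M` (the arithmetic of the printed instance `N/M = 3` odd). [folklore] -/
private theorem not_three_mul_dvd_two_mul (M M' : ℕ+) (h3 : ((M' : ℕ) : ℤ) = 3 * ((M : ℕ) : ℤ)) :
    ¬ ((M' : ℕ) : ℤ) ∣ 2 * ((M : ℕ) : ℤ) := by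
  rw [h3]
  rintro ⟨k, hk⟩
  have hMpos : (0 : ℤ) < ((M : ℕ) : ℤ) := by exact_mod_cast M.pos
  have h2 : (2 : ℤ) = 3 * k := by nlinarith [hMpos]
  omega

include hHuu in
/-- **The printed instance «`N/M` odd»: `M' = 3M`** (so `M'/M = 3` is ODD and `M' ∤ 2M`) — at the Tate datum of record,
for any tower containing both levels, the odd-lifting clause of Cor. 2.18 (iv) FAILS for the model bi-theta
environments. [cite: MochizukiEtTh2009, Rmk 2.18.1 p.63] -/
theorem not_forall_biIso_lift_three_mul_modelTate_inr (M M' : Es) (h : (M : ℕ+) ∣ M')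
    (h3 : (((M' : ℕ+) : ℕ) : ℤ) = 3 * (((M : ℕ+) : ℕ) : ℤ)) :
    ¬ ∀ (η' : (C.thetaEnvTower τ (compat_modelχq p 1 2 even_two) (ThetaSetting.modelχq_sec2Hyps p 1 2 even_two)).PiYdd → (C.thetaEnvTower τ (compat_modelχq p 1 2 even_two) (ThetaSetting.modelχq_sec2Hyps p 1 2 even_two)).mu M') (hη' : η' ∈ (C.thetaEnvTower τ (compat_modelχq p 1 2 even_two) (ThetaSetting.modelχq_sec2Hyps p 1 2 even_two)).thetaCocycles M')
        (α : (((C.thetaEnvTower τ (compat_modelχq p 1 2 even_two) (ThetaSetting.modelχq_sec2Hyps p 1 2 even_two)).level M).modelBi ((C.thetaEnvTower τ (compat_modelχq p 1 2 even_two) (ThetaSetting.modelχq_sec2Hyps p 1 2 even_two)).red_cocycle_mem M M' h η' hη')).Iso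
          (((C.thetaEnvTower τ (compat_modelχq p 1 2 even_two) (ThetaSetting.modelχq_sec2Hyps p 1 2 even_two)).level M).modelBi ((C.thetaEnvTower τ (compat_modelχq p 1 2 even_two) (ThetaSetting.modelχq_sec2Hyps p 1 2 even_two)).red_cocycle_mem M M' h η' hη'))),
        ∃ (α' : (((C.thetaEnvTower τ (compat_modelχq p 1 2 even_two) (ThetaSetting.modelχq_sec2Hyps p 1 2 even_two)).level M').modelBi hη').Iso (((C.thetaEnvTower τ (compat_modelχq p 1 2 even_two) (ThetaSetting.modelχq_sec2Hyps p 1 2 even_two)).level M').modelBi hη')) (c : (C.thetaEnvTower τ (compat_modelχq p 1 2 even_two) (ThetaSetting.modelχq_sec2Hyps p 1 2 even_two)).mu M),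
          (C.thetaEnvTower τ (compat_modelχq p 1 2 even_two) (ThetaSetting.modelχq_sec2Hyps p 1 2 even_two)).Reduces h α'.e.toMulEquiv
            (MulAut.conj (CycEnvelope.inMu ((C.thetaEnvTower τ (compat_modelχq p 1 2 even_two) (ThetaSetting.modelχq_sec2Hyps p 1 2 even_two)).level M).augY ((C.thetaEnvTower τ (compat_modelχq p 1 2 even_two) (ThetaSetting.modelχq_sec2Hyps p 1 2 even_two)).chi M) c) * α.e.toMulEquiv) :=
  not_forall_biIso_lift_modelTate_inr p hl C hHuu τ M M' h (not_three_mul_dvd_two_mul (M : ℕ+) (M' : ℕ+) h3)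

end SettingModel

end Literature.AnabelianGeometry.EtaleTheta

end
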